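import Literature.MathematicalPhysics.QuantumFieldTheory.Balaban1983to89.T4HistoryLipschitzRescaling
import Literature.MathematicalPhysics.QuantumFieldTheory.Balaban1983to89.TreeLengthTorusTransfer

/-!
# The rescaling inequality [II] (2.36) ON THE TORUS (lattice-edge reading of `d_k`)

`T4HistoryLipschitzRescaling` proves, for cube families `X ⊆ ℤ^ν` with a skeleton, the lattice-edge form of
[Balaban1988RG2Cluster] ([II]) (2.36) p.19, «2d_k(Z_i) ≥ Ld_{k+1}(Z′_i)»: `(L − 2n)·d(blocks of X̃ⁿ) ≤ d(X)`, in
particular `(L−2)·d(Z′) ≤ d(Z)` and the printed `L·d(Z′) ≤ 2d(Z)` for every `L ≥ 4`.  The papers' carrier is not `ℤ^ν`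
but the TORUS: [Balaban1987RG1] ([I]) p.251 «a torus T obtained by the usual identification of boundary points of the
cube {x ∈ R^d : −L_μ ≤ x_μ ≤ L_μ, μ = 1, …, d}», carrying the lattice `T_ε` of (0.1) «with a lattice spacing ε = L^{−K}»
and the «sequence of tori denoted by T^{(k)}_{L^k ε} and defined by (0.1) with ε replaced by L^k ε, k = 1, 2, …» (p.251;
at scale `j` the space is «scaled properly, so that it corresponds to the lattice T_ξ, ξ = L^{−j}», p.257), p.257
(localization domains = connected families of cubes of a partition of the torus, «two consecutive cubes have a common
wall»); and the end-to-end theorem of this package's NE9 / fading-memory chain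
(`T4HistoryLipschitzLinearSize.torus_ne9_and_fadingMemory_of_linSizeDecay`) is stated on the discrete torus
`Fin ν → ZMod N` with `WallAdj = T4HistoryLipschitzCubeGeometry.torusAdj` (`wallAdj_eq_torusAdj`, `rfl`).  This module
TRANSPORTS the rescaling inequality to the torus, in the two-torus vocabulary of `TreeLengthTorusTransfer` (reader seat
pv22): fine torus `TPt ν (L·N′) = Fin ν → ZMod (L·N′)` (scale `k`: `L·N′` cubes per direction), coarse torus `TPt ν N′`
(scale `k+1`), block map `tcoarse L N′` (coordinatewise `⌊·/L⌋` on the standard lift), `X̃ = tcollar X`, and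
`Z′ = tclosure L N′ Z` = «the smallest localization domain from 𝐃_{k+1} containing Z̃_i» ([II] p.19).

Main results (`ν`, `L`, `N′` arbitrary, `[NeZero L] [NeZero N′]`):
* `sub_mul_linSize_tcoarsen_tthicken_le`: `(L − 2n)·linSize (tcoarsen L N′ (tthicken n X̄)) ≤ linSize X̄` for every cube
  family `X̄` of the fine torus with a skeleton and `2n + 1 ≤ L`;
* `tthicken_one_eq_tcollar`, `tcoarsen_tthicken_one`: for `n = 1` these are pv22's `tcollar` / `tclosure`, whence
  `sub_two_mul_linSize_tclosure_le` (`(L−2)·d(Z′) ≤ d(Z̄)`, `L ≥ 3`), `printed236_torus` (`L·d(Z′) ≤ 2d(Z̄)`, every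
  `L ≥ 4`), `linSize_tclosure_eq_zero`, and the exponential (fading-memory) forms `exp_neg_mul_linSize_le_exp_tclosure`,
  `exp_neg_mul_linSize_le_exp_half_torus`;
* `tAdj_iff_wallAdj`, `tLinked_iff_reach`, `isTDom_iff_exists_isConn`: pv22's chain-connectedness `TFaceConnected` IS
  `Polymer.IsConn WallAdj` (= `torusAdj`-connectedness of the NE9 chain), so every torus localization domain has a
  skeleton (`isSkeleton_self_of_isConn`) and the results apply to all `Z̄ ∈ 𝐃_k` (`printed236_torus_of_isConn`);
* `tsysLin`, `ineq236With_tsysLin`, `ineq236Printed_tsysLin`: the LATTICE-EDGE torus catalogue (`dj = linSize`) and,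
  in the `LocDomainSys` vocabulary of `B13` (reader seat b13), `B13.Ineq236With (tsysLin ν (L·N′)) (tsysLin ν N′)
  (tclosureDom L N′) (L − 2)` (`L ≥ 3`) and `B13.Ineq236Printed (tsysLin ν (L·N′)) (tsysLin ν N′) (tclosureDom L N′) L`
  for EVERY `L ≥ 4` — the printed (2.36) as a B13-cell hypothesis shape, for the lattice-edge reading of `d_k`.

Method.  Nothing is re-proved about roundings: the three LOCAL facts of the flat proof — corner cover
(`isCorner_blockOf_roundShift`), edge transport (`roundShift_edgeAdj`) and the shift count
(`mul_card_filter_le_of_edgeAdj`) — concern one lattice edge `{c, r}` of one cube `m`, and one edge of one cube of the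
torus lifts to `ℤ^ν` verbatim (`exists_lift_edgeAdj`: standard lift `natLift` of the cube, `proj_natLift`); the
shifted rounding commutes with the covering projection (`tround_proj`, from pv22's `tcoarse_proj`), and corners /
lattice edges / thickenings project to corners / lattice edges / thickenings (`isCorner_proj`, `edgeAdj_proj_of_forall`,
`proj_blockOf_mem_tcoarsen_tthicken`).  The global step is the flat file's generic averaging lemma
`exists_mul_card_image_sub_one_le` and connectivity transport `isConn_image`, applied on the torus.

Related kernel results in the tree (OTHER READING of `d_k`, recorded for orientation; none is used or restated).  For the
sup-metric continuum tree length (`TreeLength.treeLen`, [I] p.257 first formulation; cell divergence D-T2) the torus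
transfer with the PRINTED factor is `TreeLengthTorusGeometry236Printed` (`B13.Ineq236Printed (tsys d (L·N′)) (tsys d N′)
… L`, `L ≥ 8`; b13-g13), after `TreeLengthTorusTransfer.scaleTransfer_tsys` / `TreeLengthTorusGeometry236` (pv22) and the
flat `B13Geometry236(Printed)` (pv11-g2, b13-g13, adv4-g31); rows G-B13-09 / G-B13-09R / C-B13-09 / C-pv11g2-1 /
C-adv4-59 / C-pv22g3-1/2 of the cell records.  The present module is the lattice-edge reading ([I] p.257 second
formulation, `linSize`) with constant `1/(L−2)` and the printed factor for every `L ≥ 4`; the two readings are not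
termwise comparable, neither result implies the other, and no priority is claimed.

Not claimed.  (i) As in the flat file, `d_k` is read as the lattice-edge tree length `linSize` of a cube family (the
NE9 chain's carrier), not as print's continuum Steiner length.  (ii) The torus here is the discrete index torus
`(ℤ/N)^ν` of cubes of ONE partition per scale ([I] p.251: the partitions are nested, `L` «an odd, positive integer > 11»;
all results below hold for every `L` in the stated ranges).  (iii) Nothing of [II] beyond the inequality (2.36) itself is
formalised here (the R-operation (2.35) → (2.41) is the business of `T4HistoryLipschitzRecursion` / `…LinearSize`).

ABSOLUTE RULE of the cell: no internally-minted statement enters as a cited fact — every declaration below is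
kernel-proved; docstring quotations of [I]/[II] are LABELS for which printed object a definition models, never
hypotheses; the manuscripts under audit are not cited for any disputed step.

v1 (gen 13 of the NE9-P2 lineage, census item T33 = U12-tor of `t4/T4-EST-NE9-P2.md`).  v1.0.1 (gen 14): DOCSTRINGS
ONLY, every declaration byte-identical to v1 — the p.251 torus sentence and the p.257 `d_k` sentences are now quoted
verbatim (outside cross-read C-t4r3-57 DOCFIX-1 / INFO-1 = citation police P-t4lit1g6-6: v1 had a paraphrase inside
guillemets at `tsysLin` and the composite symbol `T_η` inside the p.251 quotation).  Imports
`T4HistoryLipschitzRescaling` (this lineage, v1.0.1) and `TreeLengthTorusTransfer` (pv22; BY NAME: `TPt`, `proj`,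
`natLift`, `proj_natLift`, `TAdj`, `TLinked`, `TFaceConnected`, `IsTDom`, `TDom`, `tcoarse`, `tcoarse_proj`, `tblock`,
`tcollar`, `subset_tcollar`, `tclosure`, `tclosureDom`, `tFaceConnected_tclosure`; `B13ScaleTransfer.block`,
`B13.Ineq236With`, `B13.Ineq236Printed`, `B13.exp_transfer_of_ineq236With`).
-/

noncomputable section

namespace Literature.MathematicalPhysics.QuantumFieldTheory.Balaban1983to89.T4HistoryLipschitzRescalingTorus

open scoped BigOperators
open Literature.MathematicalPhysics.QuantumFieldTheory.Balaban1983to89.T4HistoryLipschitzLinearSize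
open Literature.MathematicalPhysics.QuantumFieldTheory.Balaban1983to89.T4HistoryLipschitzRescaling
open Literature.MathematicalPhysics.QuantumFieldTheory.Balaban1983to89.TreeLengthTorus
  (TPt proj proj_apply natLift proj_natLift TAdj TStepIn TLinked TFaceConnected IsTDom TDom)
open Literature.MathematicalPhysics.QuantumFieldTheory.Balaban1983to89.TreeLengthTorusTransfer
  (tcoarse tcoarse_proj tblock tcollar subset_tcollar tclosure tclosureDom tclosureDom_val tFaceConnected_tclosure)
open Literature.MathematicalPhysics.QuantumFieldTheory.Balaban1983to89.B13ScaleTransfer (Pt block mem_block coarse)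

variable {ν : ℕ}

/-! ## §1. The covering projection `proj N : ℤ^ν → (ℤ/N)^ν` on corners, lattice edges and blocks -/

/-- `proj` is additive. [folklore] -/
theorem proj_add (N : ℕ) (x y : Pt ν) : proj N (x + y) = proj N x + proj N y := by
  funext i; simp [proj, Int.cast_add]

/-- `proj` commutes with subtraction. [folklore] -/
theorem proj_sub (N : ℕ) (x y : Pt ν) : proj N (x - y) = proj N x - proj N y := by
  funext i; simp [proj, Int.cast_sub]

/-- The indicator vector of a set of directions projects to itself. [folklore] -/
theorem proj_cornerVec (N : ℕ) (ε : Finset (Fin ν)) : proj N (cornerVec ε) = cornerVec ε := by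
  funext i; by_cases h : i ∈ ε <;> simp [proj, cornerVec, h]

/-- Corners of a cube project to corners of the projected cube. [folklore] -/
theorem isCorner_proj (N : ℕ) {m c : Pt ν} (h : IsCorner m c) : IsCorner (proj N m) (proj N c) := by
  obtain ⟨ε, rfl⟩ := h
  exact ⟨ε, by rw [proj_add, proj_cornerVec]⟩

/-- Lattice edges of a cube family project to lattice edges of any torus family containing the projected cubes.
[folklore] -/
theorem edgeAdj_proj_of_forall (N : ℕ) {Y : Finset (Pt ν)} {Y' : Finset (TPt ν N)} {u v : Pt ν}
    (h : EdgeAdj Y u v) (hY : ∀ b ∈ Y, proj N b ∈ Y') : EdgeAdj Y' (proj N u) (proj N v) := by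
  obtain ⟨b, hb, ε, j, hj, h⟩ := h
  refine ⟨proj N b, hY b hb, ε, j, hj, ?_⟩
  rcases h with ⟨rfl, rfl⟩ | ⟨rfl, rfl⟩
  · exact Or.inl ⟨by rw [proj_add, proj_cornerVec], by rw [proj_add, proj_cornerVec]⟩
  · exact Or.inr ⟨by rw [proj_add, proj_cornerVec], by rw [proj_add, proj_cornerVec]⟩

/-- LIFTING ONE LATTICE EDGE OF THE TORUS: a lattice edge `{c̄, r̄}` of a cube `m̄ ∈ X̄` of the torus is the projection of a
lattice edge `{c, r}` of the single cube `natLift m̄` of `ℤ^ν` (standard lift). [folklore] -/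
theorem exists_lift_edgeAdj {N : ℕ} [NeZero N] {X : Finset (TPt ν N)} {c r : TPt ν N} (h : EdgeAdj X c r) :
    ∃ x : Pt ν, proj N x ∈ X ∧ ∃ c₀ r₀ : Pt ν,
      proj N c₀ = c ∧ proj N r₀ = r ∧ EdgeAdj ({x} : Finset (Pt ν)) c₀ r₀ := by
  obtain ⟨m, hm, ε, i, hi, hcr⟩ := h
  refine ⟨natLift m, by rwa [proj_natLift], ?_⟩
  rcases hcr with ⟨hc, hr⟩ | ⟨hr, hc⟩
  · refine ⟨natLift m + cornerVec ε, natLift m + cornerVec (insert i ε), ?_, ?_,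
      ⟨natLift m, Finset.mem_singleton_self _, ε, i, hi, Or.inl ⟨rfl, rfl⟩⟩⟩
    · rw [proj_add, proj_cornerVec, proj_natLift, hc]
    · rw [proj_add, proj_cornerVec, proj_natLift, hr]
  · refine ⟨natLift m + cornerVec (insert i ε), natLift m + cornerVec ε, ?_, ?_,
      ⟨natLift m, Finset.mem_singleton_self _, ε, i, hi, Or.inr ⟨rfl, rfl⟩⟩⟩
    · rw [proj_add, proj_cornerVec, proj_natLift, hc]
    · rw [proj_add, proj_cornerVec, proj_natLift, hr]

/-! ## §2. Thickening, block families and shifted roundings on the two tori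

Fine torus `TPt ν (L·N′)` (scale `k`), coarse torus `TPt ν N′` (scale `k+1`); the block map is pv22's `tcoarse L N′`. -/

/-- `X̃ⁿ` ON THE TORUS: the cube family `X̄` thickened by `n` layers of cubes of the torus, wrap-around included ([I]
p.257 «□̃ⁿ as a cube of the size (1 + 2n)M and with a center at the center of □», «The meaning of the symbol X̃ⁿ should
be obvious»); for `n = 1` it is pv22's `tcollar` (`tthicken_one_eq_tcollar`). [cite: Balaban1987RG1, p.257 (definition of X̃ⁿ)] -/
def tthicken {N : ℕ} (n : ℕ) (X : Finset (TPt ν N)) : Finset (TPt ν N) :=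
  (X ×ˢ offsets ν n).image fun q => q.1 + proj N q.2

/-- THE BLOCK FAMILY of a family of cubes of the fine torus: the cubes of the coarse torus (blocks) met by it — for
`Y = Z̃` this is `Z′` ([II] p.19), pv22's `tclosure` (`tcoarsen_tthicken_one`). [cite: Balaban1988RG2Cluster, p.19 (definition of Z′)] -/
def tcoarsen (L N' : ℕ) (Y : Finset (TPt ν (L * N'))) : Finset (TPt ν N') := Y.image (tcoarse L N')

/-- the SHIFTED ROUNDING on the torus: translate by the (lattice) shift `s`, then take the block. [folklore] -/
def tround (L N' : ℕ) (s : Pt ν) (a : TPt ν (L * N')) : TPt ν N' := tcoarse L N' (a + proj (L * N') s)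

/-- Membership in the torus thickening. [folklore] -/
theorem mem_tthicken {N n : ℕ} {X : Finset (TPt ν N)} {y : TPt ν N} :
    y ∈ tthicken n X ↔ ∃ m ∈ X, ∃ δ ∈ offsets ν n, m + proj N δ = y := by
  constructor
  · intro h
    obtain ⟨q, hq, rfl⟩ := Finset.mem_image.1 h
    rw [Finset.mem_product] at hq
    exact ⟨q.1, hq.1, q.2, hq.2, rfl⟩
  · rintro ⟨m, hm, δ, hδ, rfl⟩
    exact Finset.mem_image.2 ⟨(m, δ), Finset.mem_product.2 ⟨hm, hδ⟩, rfl⟩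

/-- Membership in the block family. [folklore] -/
theorem mem_tcoarsen {L N' : ℕ} {Y : Finset (TPt ν (L * N'))} {b : TPt ν N'} :
    b ∈ tcoarsen L N' Y ↔ ∃ y ∈ Y, tcoarse L N' y = b :=
  Finset.mem_image

/-- The torus block map on a projected index is the projection of the flat block corner `⌊x/L⌋` (pv22's
`tcoarse_proj`, with `B13ScaleTransfer.coarse L = blockOf L` definitionally). [folklore] -/
theorem tcoarse_proj_blockOf {L N' : ℕ} [NeZero L] [NeZero N'] (x : Pt ν) :
    tcoarse L N' (proj (L * N') x) = proj N' (T4HistoryLipschitzRescaling.blockOf L x) :=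
  tcoarse_proj x

/-- The shifted rounding commutes with the covering projections: `tround s (proj x) = proj (roundShift s x)`. [folklore] -/
theorem tround_proj {L N' : ℕ} [NeZero L] [NeZero N'] (s x : Pt ν) :
    tround L N' s (proj (L * N') x) = proj N' (roundShift L s x) := by
  unfold tround
  rw [← proj_add, tcoarse_proj_blockOf]
  rfl

/-- Blocks of the flat thickening of one lifted cube project into the torus block family of the torus thickening.
[cite: Balaban1987RG1, p.257 (definition of X̃ⁿ; «connected by scaling transformations»)] -/
theorem proj_blockOf_mem_tcoarsen_tthicken {L N' : ℕ} [NeZero L] [NeZero N'] {n : ℕ} {X : Finset (TPt ν (L * N'))}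
    {x : Pt ν} (hx : proj (L * N') x ∈ X) {b : Pt ν} (hb : b ∈ coarsen L (thicken n {x})) :
    proj N' b ∈ tcoarsen L N' (tthicken n X) := by
  obtain ⟨y, hy, rfl⟩ := Finset.mem_image.1 hb
  obtain ⟨c, hc, δ, hδ, rfl⟩ := mem_thicken.1 hy
  rw [Finset.mem_singleton] at hc
  subst hc
  rw [← tcoarse_proj_blockOf, proj_add]
  exact mem_tcoarsen.2 ⟨_, mem_tthicken.2 ⟨_, hx, δ, hδ, rfl⟩, rfl⟩

/-! ## §3. The three local facts, transported to the torus -/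

section TwoTori

variable {L N' : ℕ} [NeZero L] [NeZero N']

/-- (cover) an admissible shifted rounding maps the corners of a cube `m̄` of the fine torus to corners of the block of
every cube of `m̃ⁿ` (from the flat `isCorner_blockOf_roundShift`). [cite: Balaban1988RG2Cluster, (2.36) p.19 (proof, torus carrier of [I] p.251)] -/
theorem isCorner_tcoarse_tround {n : ℕ} (hL : 2 * n + 1 ≤ L) {s : Pt ν} (hs : s ∈ shifts ν L n)
    {m p : TPt ν (L * N')} (hp : IsCorner m p) {δ : Pt ν} (hδ : δ ∈ offsets ν n) :
    IsCorner (tcoarse L N' (m + proj (L * N') δ)) (tround L N' s p) := by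
  obtain ⟨ε, rfl⟩ := hp
  obtain ⟨x, rfl⟩ : ∃ x : Pt ν, proj (L * N') x = m := ⟨natLift m, proj_natLift m⟩
  have h := isCorner_blockOf_roundShift hL hs (isCorner_add_cornerVec x ε) hδ
  rw [← proj_cornerVec (L * N') ε, ← proj_add, ← proj_add, tround_proj, tcoarse_proj_blockOf]
  exact isCorner_proj N' h

/-- (edge) an admissible shifted rounding maps a lattice edge of `X̄` to a point or to a lattice edge of the block family
of `X̃ⁿ` (from the flat `roundShift_edgeAdj`, through the lift of the edge). [cite: Balaban1988RG2Cluster, (2.36) p.19 (proof, torus carrier of [I] p.251)] -/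
theorem tround_edgeAdj {n : ℕ} (hL : 2 * n + 1 ≤ L) {s : Pt ν} (hs : s ∈ shifts ν L n)
    {X : Finset (TPt ν (L * N'))} {c r : TPt ν (L * N')} (h : EdgeAdj X c r) :
    tround L N' s c = tround L N' s r ∨
      EdgeAdj (tcoarsen L N' (tthicken n X)) (tround L N' s c) (tround L N' s r) := by
  obtain ⟨x, hxX, c₀, r₀, rfl, rfl, h₀⟩ := exists_lift_edgeAdj h
  rw [tround_proj, tround_proj]
  rcases roundShift_edgeAdj hL hs h₀ with h1 | h1
  · exact Or.inl (by rw [h1])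
  · exact Or.inr (edgeAdj_proj_of_forall N' h1 fun b hb => proj_blockOf_mem_tcoarsen_tthicken hxX hb)

/-- (few) along a lattice edge of `X̄`, at most a fraction `1/(L − 2n)` of the admissible shifts give different
roundings of its two endpoints (from the flat `mul_card_filter_le_of_edgeAdj`). [cite: Balaban1988RG2Cluster, (2.36) p.19 (proof, torus carrier of [I] p.251)] -/
theorem mul_card_filter_tround_ne_le {n : ℕ} (hL : 2 * n + 1 ≤ L) {X : Finset (TPt ν (L * N'))}
    {c r : TPt ν (L * N')} (h : EdgeAdj X c r) :
    (L - 2 * n) * ((shifts ν L n).filter fun s => tround L N' s c ≠ tround L N' s r).card ≤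
      (shifts ν L n).card := by
  classical
  obtain ⟨x, -, c₀, r₀, rfl, rfl, h₀⟩ := exists_lift_edgeAdj h
  refine le_trans (Nat.mul_le_mul_left _ (Finset.card_le_card ?_)) (mul_card_filter_le_of_edgeAdj hL h₀)
  intro s hs
  rw [Finset.mem_filter] at hs ⊢
  refine ⟨hs.1, fun heq => hs.2 ?_⟩
  rw [tround_proj, tround_proj, heq]

/-- An admissible shifted rounding maps a skeleton of `X̄` onto a skeleton of the block family of `X̃ⁿ`. [cite: Balaban1988RG2Cluster, (2.36) p.19 (proof, torus carrier of [I] p.251)] -/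
theorem isSkeleton_image_tround {n : ℕ} (hL : 2 * n + 1 ≤ L) {s : Pt ν} (hs : s ∈ shifts ν L n)
    {X S : Finset (TPt ν (L * N'))} (hS : IsSkeleton X S) :
    IsSkeleton (tcoarsen L N' (tthicken n X)) (S.image (tround L N' s)) := by
  classical
  obtain ⟨⟨a, ha, hconn⟩, hcov⟩ := hS
  refine ⟨⟨tround L N' s a, Finset.mem_image_of_mem _ ha,
    isConn_image _ (fun x _ y _ hxy => tround_edgeAdj hL hs hxy) hconn⟩, ?_⟩
  intro β hβ
  obtain ⟨y, hy, rfl⟩ := mem_tcoarsen.1 hβ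
  obtain ⟨m, hm, δ, hδ, rfl⟩ := mem_tthicken.1 hy
  obtain ⟨p, hp, hmp⟩ := hcov m hm
  exact ⟨tround L N' s p, Finset.mem_image_of_mem _ hp, isCorner_tcoarse_tround hL hs hmp hδ⟩

/-! ## §4. The rescaling inequality on the torus -/

/-- **THE RESCALING INEQUALITY ON THE TORUS: `(L − 2n) · d(blocks of X̃ⁿ) ≤ d(X̄)`** for every cube family `X̄` of the
fine torus `(ℤ/LN′)^ν` with a skeleton and every `L ≥ 2n + 1` — the torus form of
`T4HistoryLipschitzRescaling.sub_mul_linSize_coarsen_thicken_le`; with `n = 1` the form `(L−2)·d(Z′) ≤ d(Z̄)` of [II]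
(2.36) «2d_k(Z_i) ≥ Ld_{k+1}(Z′_i)» on the papers' periodic carrier ([I] p.251). [cite: Balaban1988RG2Cluster, (2.36) p.19] -/
theorem sub_mul_linSize_tcoarsen_tthicken_le {X : Finset (TPt ν (L * N'))} (hX : ∃ S, IsSkeleton X S) {n : ℕ}
    (hL : 2 * n + 1 ≤ L) : (L - 2 * n) * linSize (tcoarsen L N' (tthicken n X)) ≤ linSize X := by
  classical
  obtain ⟨S, hS, hcard⟩ := exists_isSkeleton_card_eq hX
  obtain ⟨a, ha, hconn⟩ := hS.1
  obtain ⟨s, hs, hle⟩ := exists_mul_card_image_sub_one_le (shifts ν L n) (shifts_nonempty hL)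
    (fun s p => tround L N' s p) (fun c r hcr => mul_card_filter_tround_ne_le hL hcr) S a hconn
  have h1 := linSize_le_card_sub_one_of_isSkeleton (isSkeleton_image_tround hL hs hS)
  calc (L - 2 * n) * linSize (tcoarsen L N' (tthicken n X))
      ≤ (L - 2 * n) * ((S.image (tround L N' s)).card - 1) := Nat.mul_le_mul_left _ h1
    _ ≤ S.card - 1 := hle
    _ = linSize X := by omega

/-- For `n = 1` the torus thickening is pv22's `tcollar` (`X̃`: one layer of cubes of the torus adjoined, the union of
the `3^ν`-blocks `tblock` = projections of `B13ScaleTransfer.block` of the standard lifts). [cite: Balaban1987RG1, p.257 (definition of X̃ⁿ)] -/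
theorem tthicken_one_eq_tcollar {N : ℕ} [NeZero N] (X : Finset (TPt ν N)) : tthicken 1 X = tcollar X := by
  classical
  ext y
  rw [mem_tthicken]
  simp only [tcollar, Finset.mem_biUnion, tblock, Finset.mem_image]
  constructor
  · rintro ⟨m, hm, δ, hδ, rfl⟩
    refine ⟨m, hm, natLift m + δ, ?_, by rw [proj_add, proj_natLift]⟩
    rw [mem_offsets] at hδ
    rw [mem_block]
    intro i
    have := hδ i
    simp only [Pi.add_apply, Nat.cast_one] at this ⊢
    omega
  · rintro ⟨m, hm, x, hx, rfl⟩
    refine ⟨m, hm, x - natLift m, ?_, ?_⟩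
    · rw [mem_block] at hx
      rw [mem_offsets]
      intro i
      have := hx i
      simp only [Pi.sub_apply, Nat.cast_one]
      omega
    · rw [proj_sub, proj_natLift, add_sub_cancel]

/-- For `n = 1` the torus block family of `Z̃` is pv22's `tclosure L N′ Z̄` = `Z′`. [cite: Balaban1988RG2Cluster, p.19 (definition of Z′)] -/
theorem tcoarsen_tthicken_one (Z : Finset (TPt ν (L * N'))) : tcoarsen L N' (tthicken 1 Z) = tclosure L N' Z := by
  rw [tthicken_one_eq_tcollar]
  rfl

/-- **`(L − 2) · d_{k+1}(Z′) ≤ d_k(Z̄)` ON THE TORUS** (`L ≥ 3`), `Z′ = tclosure L N′ Z̄`. [cite: Balaban1988RG2Cluster, (2.36) p.19] -/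
theorem sub_two_mul_linSize_tclosure_le {Z : Finset (TPt ν (L * N'))} (hZ : ∃ S, IsSkeleton Z S) (hL : 3 ≤ L) :
    (L - 2) * linSize (tclosure L N' Z) ≤ linSize Z := by
  have h := sub_mul_linSize_tcoarsen_tthicken_le hZ (n := 1) (by omega)
  rwa [tcoarsen_tthicken_one, Nat.mul_one] at h

/-- **[II] (2.36) AS PRINTED ON THE TORUS, `L · d_{k+1}(Z′) ≤ 2 · d_k(Z̄)`, FOR EVERY `L ≥ 4`.** [II] p.19, verbatim: «We
extract exp(−δκd_k(Z_i)) from each exponential in (2.35), corresponding to one of these components. The remaining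
exponential is bounded using the following inequality: 2d_k(Z_i) ≥ Ld_{k+1}(Z′_i). (2.36)» [cite: Balaban1988RG2Cluster, (2.36) p.19] -/
theorem printed236_torus {Z : Finset (TPt ν (L * N'))} (hZ : ∃ S, IsSkeleton Z S) (hL : 4 ≤ L) :
    L * linSize (tclosure L N' Z) ≤ 2 * linSize Z := by
  have h1 := sub_two_mul_linSize_tclosure_le hZ (by omega)
  set d' := linSize (tclosure L N' Z)
  set d := linSize Z
  have h2 : 2 * d' ≤ (L - 2) * d' := Nat.mul_le_mul_right d' (by omega)
  have h3 : L * d' = (L - 2) * d' + 2 * d' := by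
    rw [← Nat.add_mul, Nat.sub_add_cancel (by omega : 2 ≤ L)]
  calc L * d' = (L - 2) * d' + 2 * d' := h3
    _ ≤ d + (L - 2) * d' := Nat.add_le_add h1 h2
    _ ≤ d + d := Nat.add_le_add_left h1 d
    _ = 2 * d := (two_mul d).symm

/-- [II] (2.36) on the torus in print's standing range [I] p.251 «where L is an odd, positive integer > 11». [cite: Balaban1988RG2Cluster, (2.36) p.19] -/
theorem printed236_torus_of_eleven_lt {Z : Finset (TPt ν (L * N'))} (hZ : ∃ S, IsSkeleton Z S) (hL : 11 < L) :
    L * linSize (tclosure L N' Z) ≤ 2 * linSize Z :=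
  printed236_torus hZ (by omega)

/-- **SMALL DOMAINS DO NOT PROPAGATE ON THE TORUS: `d(Z̄) < L − 2 ⟹ d(Z′) = 0`.** [cite: Balaban1988RG2Cluster, (2.36) p.19] -/
theorem linSize_tclosure_eq_zero {Z : Finset (TPt ν (L * N'))} (hZ : ∃ S, IsSkeleton Z S) (hL : 3 ≤ L)
    (hd : linSize Z < L - 2) : linSize (tclosure L N' Z) = 0 := by
  have h1 := sub_two_mul_linSize_tclosure_le hZ hL
  by_contra h0
  have h2 : L - 2 ≤ (L - 2) * linSize (tclosure L N' Z) := Nat.le_mul_of_pos_right _ (Nat.pos_of_ne_zero h0)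
  omega

/-- The exponential form for general `n`: `exp(−a·d(X̄)) ≤ exp(−a(L−2n)·d(blocks of X̃ⁿ))`, `0 ≤ a`, `2n + 1 ≤ L`
(torus form of `T4HistoryLipschitzRescaling.exp_neg_mul_linSize_le_exp_coarsen`). [cite: Balaban1988RG2Cluster, (2.36)–(2.37) pp.19–20] -/
theorem exp_neg_mul_linSize_le_exp_tcoarsen {X : Finset (TPt ν (L * N'))} (hX : ∃ S, IsSkeleton X S) {n : ℕ}
    (hL : 2 * n + 1 ≤ L) {a : ℝ} (ha : 0 ≤ a) :
    Real.exp (-a * (linSize X : ℝ)) ≤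
      Real.exp (-(a * ((L : ℝ) - 2 * n)) * (linSize (tcoarsen L N' (tthicken n X)) : ℝ)) := by
  have h1 := sub_mul_linSize_tcoarsen_tthicken_le hX hL
  have h2 : ((L - 2 * n : ℕ) : ℝ) * (linSize (tcoarsen L N' (tthicken n X)) : ℝ) ≤ (linSize X : ℝ) := by
    exact_mod_cast h1
  have h3 : ((L - 2 * n : ℕ) : ℝ) = (L : ℝ) - 2 * n := by
    rw [Nat.cast_sub (by omega : 2 * n ≤ L)]; push_cast; ring
  rw [h3] at h2
  apply Real.exp_le_exp.2
  nlinarith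

/-- **THE PER-STEP FADING-MEMORY FACTOR ON THE TORUS (exponential form).**  For `0 ≤ a`:
`exp(−a·d_k(Z̄)) ≤ exp(−a(L−2)·d_{k+1}(Z′))`, `L ≥ 3` — the step (2.35) → (2.37) of [II] pp.19–20 applied to the
remaining rate `a` (p.20 «(1 − 5δ)κd_k(Z_i) in the exponentials replaced by (1 − 6δ)½Lκd_{k+1}(Z′_i)»; kernel rate
`a(L−2) ≥ ½La` for `L ≥ 4`). [cite: Balaban1988RG2Cluster, (2.36)–(2.37) pp.19–20] -/
theorem exp_neg_mul_linSize_le_exp_tclosure {Z : Finset (TPt ν (L * N'))} (hZ : ∃ S, IsSkeleton Z S) (hL : 3 ≤ L)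
    {a : ℝ} (ha : 0 ≤ a) :
    Real.exp (-a * (linSize Z : ℝ)) ≤ Real.exp (-(a * ((L : ℝ) - 2)) * (linSize (tclosure L N' Z) : ℝ)) := by
  have h1 := sub_two_mul_linSize_tclosure_le hZ hL
  have h2 : ((L - 2 : ℕ) : ℝ) * (linSize (tclosure L N' Z) : ℝ) ≤ (linSize Z : ℝ) := by exact_mod_cast h1
  have h3 : ((L - 2 : ℕ) : ℝ) = (L : ℝ) - 2 := by
    rw [Nat.cast_sub (by omega : 2 ≤ L)]; push_cast; ring
  rw [h3] at h2
  apply Real.exp_le_exp.2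
  nlinarith

/-- the printed rate on the torus: `exp(−a·d_k(Z̄)) ≤ exp(−(aL/2)·d_{k+1}(Z′))` for `L ≥ 4`, `0 ≤ a`.
[cite: Balaban1988RG2Cluster, (2.36)–(2.37) pp.19–20] -/
theorem exp_neg_mul_linSize_le_exp_half_torus {Z : Finset (TPt ν (L * N'))} (hZ : ∃ S, IsSkeleton Z S) (hL : 4 ≤ L)
    {a : ℝ} (ha : 0 ≤ a) :
    Real.exp (-a * (linSize Z : ℝ)) ≤ Real.exp (-(a * (L : ℝ) / 2) * (linSize (tclosure L N' Z) : ℝ)) := by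
  have h1 := printed236_torus hZ hL
  have h2 : (L : ℝ) * (linSize (tclosure L N' Z) : ℝ) ≤ 2 * (linSize Z : ℝ) := by exact_mod_cast h1
  apply Real.exp_le_exp.2
  nlinarith

end TwoTori

/-! ## §5. pv22's chain-connectedness IS wall-connectedness: every torus localization domain has a skeleton -/

/-- One coordinate raised by one: `update a i (a i + 1) = a + e_i`. [folklore] -/
theorem update_add_one_eq {N : ℕ} (a : TPt ν N) (i : Fin ν) : Function.update a i (a i + 1) = a + Pi.single i 1 := by
  funext j
  by_cases h : j = i
  · subst h; simp
  · simp [Function.update_of_ne h, Pi.single_eq_of_ne h]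

/-- pv22's torus wall adjacency `TAdj` (`ȳ = x̄ ± e_i` via `Function.update`) is the NE9 chain's `WallAdj`
(`= T4HistoryLipschitzCubeGeometry.torusAdj`, `wallAdj_eq_torusAdj`). [cite: Balaban1987RG1, p.257 (localization domains, «common wall»)] -/
theorem tAdj_iff_wallAdj {N : ℕ} {a b : TPt ν N} : TAdj a b ↔ WallAdj a b := by
  constructor
  · rintro ⟨i, h | h⟩
    · exact ⟨i, Or.inl (by rw [h, update_add_one_eq])⟩
    · refine ⟨i, Or.inr ?_⟩
      rw [update_add_one_eq] at h
      rw [h, add_sub_cancel_right]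
  · rintro ⟨i, h | h⟩
    · exact ⟨i, Or.inl (by rw [h, update_add_one_eq])⟩
    · refine ⟨i, Or.inr ?_⟩
      rw [update_add_one_eq, h, sub_add_cancel]

/-- pv22's chain-connectedness inside `S̄` is `Polymer.Reach WallAdj S̄`. [cite: Balaban1987RG1, p.257 (localization domains)] -/
theorem tLinked_iff_reach {N : ℕ} {S : Finset (TPt ν N)} {a b : TPt ν N} :
    TLinked S a b ↔ Polymer.Reach WallAdj S a b := by
  rw [Polymer.reach_iff_reflTransGen]
  have h : TStepIn S = fun x y => WallAdj x y ∧ x ∈ S ∧ y ∈ S := by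
    funext x y
    exact propext ⟨fun h => ⟨tAdj_iff_wallAdj.1 h.2.2, h.1, h.2.1⟩,
      fun h => ⟨h.2.1, h.2.2, tAdj_iff_wallAdj.2 h.1⟩⟩
  unfold TLinked
  rw [h]

/-- A torus localization domain (pv22's `TFaceConnected`, [I] p.257 «two consecutive cubes have a common wall») is
wall-connected in the sense of the NE9 chain (`Polymer.IsConn WallAdj`). [cite: Balaban1987RG1, p.257 (localization domains)] -/
theorem isConn_of_tFaceConnected {N : ℕ} {S : Finset (TPt ν N)} {a : TPt ν N} (ha : a ∈ S)
    (h : TFaceConnected S) : Polymer.IsConn WallAdj S a :=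
  ⟨ha, fun b hb => tLinked_iff_reach.1 (h a ha b hb)⟩

/-- Conversely, a wall-connected family is a torus localization domain in pv22's sense. [cite: Balaban1987RG1, p.257 (localization domains)] -/
theorem tFaceConnected_of_isConn {N : ℕ} {S : Finset (TPt ν N)} {a : TPt ν N} (h : Polymer.IsConn WallAdj S a) :
    TFaceConnected S :=
  fun x hx y hy => tLinked_iff_reach.2 ((h.2 x hx).symm.trans (h.2 y hy))

/-- `IsTDom S̄ ↔ ∃ a, Polymer.IsConn WallAdj S̄ a`: the two formalisations of «localization domain» on the torus agree.
[cite: Balaban1987RG1, p.257 (localization domains)] -/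
theorem isTDom_iff_exists_isConn {N : ℕ} {S : Finset (TPt ν N)} : IsTDom S ↔ ∃ a, Polymer.IsConn WallAdj S a :=
  ⟨fun ⟨⟨a, ha⟩, h⟩ => ⟨a, isConn_of_tFaceConnected ha h⟩, fun ⟨a, h⟩ => ⟨⟨a, h.1⟩, tFaceConnected_of_isConn h⟩⟩

/-- Every torus localization domain has a skeleton (itself). [cite: Balaban1987RG1, p.257 (localization domains; d_k second formulation)] -/
theorem exists_isSkeleton_of_isTDom {N : ℕ} {S : Finset (TPt ν N)} (h : IsTDom S) : ∃ T, IsSkeleton S T := by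
  obtain ⟨a, ha⟩ := isTDom_iff_exists_isConn.1 h
  exact ⟨S, isSkeleton_self_of_isConn ha⟩

section TwoTori

variable {L N' : ℕ} [NeZero L] [NeZero N']

/-- [II] (2.36) as printed, on the torus, for every wall-connected `Z̄` (every `Z̄ ∈ 𝐃_k`) and every `L ≥ 4`. [cite: Balaban1988RG2Cluster, (2.36) p.19] -/
theorem printed236_torus_of_isConn {Z : Finset (TPt ν (L * N'))} {a : TPt ν (L * N')}
    (hZ : Polymer.IsConn WallAdj Z a) (hL : 4 ≤ L) : L * linSize (tclosure L N' Z) ≤ 2 * linSize Z :=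
  printed236_torus ⟨Z, isSkeleton_self_of_isConn hZ⟩ hL

/-- The same with the NE9 chain's name `torusAdj` for the adjacency (`WallAdj = torusAdj` definitionally). [cite: Balaban1988RG2Cluster, (2.36) p.19] -/
theorem printed236_torus_of_isConn_torusAdj {Z : Finset (Fin ν → ZMod (L * N'))} {a : Fin ν → ZMod (L * N')}
    (hZ : Polymer.IsConn (T4HistoryLipschitzCubeGeometry.torusAdj ν (L * N')) Z a) (hL : 4 ≤ L) :
    L * linSize (tclosure L N' Z) ≤ 2 * linSize Z :=
  printed236_torus_of_isConn hZ hL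

/-- `(L − 2)·d(Z′) ≤ d(Z̄)` for every torus localization domain `Z̄` (pv22's `IsTDom`), `L ≥ 3`. [cite: Balaban1988RG2Cluster, (2.36) p.19] -/
theorem sub_two_mul_linSize_tclosure_le_of_isTDom {Z : Finset (TPt ν (L * N'))} (hZ : IsTDom Z) (hL : 3 ≤ L) :
    (L - 2) * linSize (tclosure L N' Z) ≤ linSize Z :=
  sub_two_mul_linSize_tclosure_le (exists_isSkeleton_of_isTDom hZ) hL

/-- `Z′` is again wall-connected and contains the block of every cube of `Z̄` (pv22's `tFaceConnected_tclosure`,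
`subset_tcollar`). [cite: Balaban1988RG2Cluster, p.19 (definition of Z′)] -/
theorem isConn_tclosure {Z : Finset (TPt ν (L * N'))} {a : TPt ν (L * N')} (hZ : Polymer.IsConn WallAdj Z a) :
    Polymer.IsConn WallAdj (tclosure L N' Z) (tcoarse L N' a) :=
  isConn_of_tFaceConnected (Finset.mem_image_of_mem _ (subset_tcollar Z hZ.1))
    (tFaceConnected_tclosure (tFaceConnected_of_isConn hZ))

end TwoTori

/-! ## §6. The lattice-edge torus catalogue and (2.36) as a `B13.Ineq236With` / `B13.Ineq236Printed` hypothesis -/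

/-- THE LATTICE-EDGE TORUS CATALOGUE `(𝐃_k, d_k)`: pv22's torus localization domains `TDom ν N` with `d_k` = the
lattice-edge tree length `linSize` — the second formulation of [I] p.257: after «A length of a shortest graph in this
class, divided by M, is the linear size of X, and is denoted by d_j(X).» print adds «It is easy to see that there are
also the shortest tree graphs formed by edges of cubes in X, hence an equivalent definition can be formulated, based on
such graphs only.»; `linSize` models that edge-graph definition (cf. pv22's `tsys`: same domains with the sup-metric
continuum `torusTreeLen`). [cite: Balaban1987RG1, p.257 (d_k, second formulation)] -/
def tsysLin (ν N : ℕ) [NeZero N] : LocDomainSys where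
  Dom := TDom ν N
  dj := fun X => (linSize X.1 : ℝ)
  dj_nonneg := fun _ => Nat.cast_nonneg _

/-- the domains of the lattice-edge catalogue are pv22's torus localization domains (same `Dom` as `tsys`). [folklore] -/
@[simp] theorem tsysLin_Dom {N : ℕ} [NeZero N] : (tsysLin ν N).Dom = TDom ν N := rfl

/-- `dj` of the lattice-edge catalogue. [folklore] -/
@[simp] theorem tsysLin_dj {N : ℕ} [NeZero N] (X : TDom ν N) : (tsysLin ν N).dj X = (linSize X.1 : ℝ) := rfl

section TwoTori

variable {L N' : ℕ} [NeZero L] [NeZero N']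

/-- **(2.36) IN THE B13 CELL'S VOCABULARY, factor `L − 2`:** `B13.Ineq236With (tsysLin ν (L·N′)) (tsysLin ν N′)
(tclosureDom L N′) (L − 2)` for every `L ≥ 3` — `(L−2)·d_{k+1}(Z′) ≤ d_k(Z̄)` for all `Z̄ ∈ 𝐃_k` of the fine torus.
[cite: Balaban1988RG2Cluster, (2.36) p.19] -/
theorem ineq236With_tsysLin (hL : 3 ≤ L) :
    B13.Ineq236With (tsysLin ν (L * N')) (tsysLin ν N') (tclosureDom L N') ((L : ℝ) - 2) := by
  intro Z
  have h := sub_two_mul_linSize_tclosure_le_of_isTDom (N' := N') Z.2 hL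
  have h2 : ((L - 2 : ℕ) : ℝ) * (linSize (tclosure L N' Z.1) : ℝ) ≤ (linSize Z.1 : ℝ) := by exact_mod_cast h
  have h3 : ((L - 2 : ℕ) : ℝ) = (L : ℝ) - 2 := by
    rw [Nat.cast_sub (by omega : 2 ≤ L)]; push_cast; ring
  rw [h3] at h2
  simpa [tsysLin] using h2

/-- **[II] (2.36) AS PRINTED, AS A B13-CELL HYPOTHESIS SHAPE, FOR EVERY `L ≥ 4`:** `B13.Ineq236Printed (tsysLin ν (L·N′))
(tsysLin ν N′) (tclosureDom L N′) L`, i.e. `(L/2)·d_{k+1}(Z′) ≤ d_k(Z̄)` for all `Z̄ ∈ 𝐃_k` — for the lattice-edge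
reading of `d_k` (for the sup-metric reading and `L ≥ 8` see `TreeLengthTorusGeometry236Printed`). [cite: Balaban1988RG2Cluster, (2.36) p.19] -/
theorem ineq236Printed_tsysLin (hL : 4 ≤ L) :
    B13.Ineq236Printed (tsysLin ν (L * N')) (tsysLin ν N') (tclosureDom L N') L := by
  intro Z
  have h := printed236_torus (N' := N') (exists_isSkeleton_of_isTDom Z.2) hL
  have h2 : (L : ℝ) * (linSize (tclosure L N' Z.1) : ℝ) ≤ 2 * (linSize Z.1 : ℝ) := by exact_mod_cast h
  simp only [tsysLin, tclosureDom_val]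
  linarith

/-- The exponential transfer of decay rates between the two lattice-edge torus catalogues (`B13.exp_transfer_of_ineq236With`):
`exp(−r·d_k(Z̄)) ≤ exp(−r(L−2)·d_{k+1}(Z′))`, `0 ≤ r`, `L ≥ 3`. [cite: Balaban1988RG2Cluster, (2.36)–(2.37) pp.19–20] -/
theorem exp_transfer_tsysLin (hL : 3 ≤ L) (r : ℝ) (hr : 0 ≤ r) (Z : TDom ν (L * N')) :
    Real.exp (-(r * (tsysLin ν (L * N')).dj Z)) ≤
      Real.exp (-(r * ((L : ℝ) - 2) * (tsysLin ν N').dj (tclosureDom L N' Z))) :=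
  B13.exp_transfer_of_ineq236With (ineq236With_tsysLin hL) r hr Z

end TwoTori

end Literature.MathematicalPhysics.QuantumFieldTheory.Balaban1983to89.T4HistoryLipschitzRescalingTorus

end
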